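import Mathlib
import Literature.AlgebraicGeometry.HodgeTheory.AlgebraicClassesCupAbelianVariety
import Literature.AlgebraicGeometry.HodgeTheory.HodgeTypePullback
import Literature.AlgebraicGeometry.HodgeTheory.CupPreservesHodgeTypeOfDeRham
import Literature.AlgebraicGeometry.HodgeTheory.HodgeModelExistence
import Literature.AlgebraicGeometry.HodgeTheory.HodgeFiltrationModelsReductionProofs
import Literature.AlgebraicGeometry.HodgeTheory.GysinBaseChangeOfKunneth
import Literature.AlgebraicGeometry.HodgeTheory.SupportedHodgeClassDescent
import Literature.AlgebraicGeometry.Motives.ComplexPointsOrientation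
import HarnessLib

/-!
# KunnethSpanning

Topic `Literature/AlgebraicGeometry/HodgeTheory`. Named literature fact(s) relocated by the gate from `Summits/HodgeConjecture/HodgeConjecture/Theorems/HeckePrymWeilWeilDescending.lean`
(accept-time relocation of `[cite]`d propositions written inline in a Summits proposal; human ruling 2026-08-15).
Sources: HatcherAT2002.

* `Literature.AlgebraicGeometry.HodgeTheory.kunneth_span_crossProducts`
-/

namespace Literature.AlgebraicGeometry.HodgeTheory

open scoped Manifold
open CategoryTheory MonoidalCategory CartesianMonoidalCategory
open Literature.AlgebraicGeometry Literature.AlgebraicGeometry.HodgeTheory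
open Literature.AlgebraicTopology.SingularHomology

/-- **Künneth formula for the complex points of a product of smooth projective varieties, spanning
half.** For smooth projective complex `Y`, `Z`, every class in `Hᵏ((Y × Z)(ℂ); ℂ)` is a `ℂ`-linear
combination of cross products `pr_Y^* b ∪ pr_Z^* w` (Hatcher, *Algebraic Topology*, Thm. 3.15 /
§3.B Thm. 3B.6 with field coefficients: the cross product `H*(Y(ℂ); ℂ) ⊗ H*(Z(ℂ); ℂ) → H*((Y × Z)(ℂ); ℂ)`
is an isomorphism, `(Y × Z)(ℂ) = Y(ℂ) × Z(ℂ)` being a product of compact manifolds). Spelled with the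
tree's real cup product and pull-backs, exactly as the hypothesis `hK` of
`Literature.AlgebraicGeometry.HodgeTheory.gysin_baseChange_of_kunneth`.
[cite: HatcherAT2002, §3.2 Thm. 3.15 and §3.B Thm. 3B.6] [file AlgebraicGeometry/HodgeTheory/KunnethSpanning] -/
def kunneth_span_crossProducts : Prop :=
  ∀ ⦃m n : ℕ⦄ ⦃Y Z : Literature.AlgebraicGeometry.Motives.SchemeOver ℂ⦄,
    Literature.AlgebraicGeometry.Motives.IsSmoothProjective m Y →
    Literature.AlgebraicGeometry.Motives.IsSmoothProjective n Z →
      ∀ (k : ℕ) (z : Literature.AlgebraicGeometry.HodgeTheory.complexBetti (Y ⊗ Z) k),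
        z ∈ Submodule.span ℂ
          {v | ∃ (i j : ℕ) (h : i + j = k)
            (b : Literature.AlgebraicGeometry.HodgeTheory.complexBetti Y i)
            (w : Literature.AlgebraicGeometry.HodgeTheory.complexBetti Z j),
            v = Literature.AlgebraicTopology.SingularHomology.cupProduct h
              (Literature.AlgebraicGeometry.HodgeTheory.complexBetti.map
                (CategoryTheory.CartesianMonoidalCategory.fst Y Z) i b)
              (Literature.AlgebraicGeometry.HodgeTheory.complexBetti.map
                (CategoryTheory.CartesianMonoidalCategory.snd Y Z) j w)}

end Literature.AlgebraicGeometry.HodgeTheory
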